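import Mathlib
import HarnessLib

/-!
# Reciprocal weights on a symmetric relation: the charge dominates the adjacency form
# (Proposition 43, abstract part — generation 60)

Solo-blind programme `HubbardSuperconductivity`, generation 60: the abstract half of the
ENDPOINT OF EVERY SIGN-FREE FLOOR (Proposition 43 / Corollary 43′ of the obstruction paper,
§5.20(19)).

Setting. `V` a finite type, `R` a symmetric relation on `V` (the *hops*), and a *weight scheme*
`u : V → V → ℝ` that is AM–GM admissible on hops: `u v w ≥ 0` and `u v w · u w v ≥ 1` whenever
`R v w` (in the lineage of Theorems 34 / 34′ / 42 this is `u = 2w`, `4 w w' ≥ 1`).  The *charge*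
collected by `v` is `C_u(v) = Σ_{w : R v w} u v w`.

* `two_mul_le_weighted_sq_add` — reciprocal AM–GM: `u ≥ 0`, `u u' ≥ 1` ⇒ `2ab ≤ u a² + u' b²`.
* `adjForm_le_chargeForm` — for every `φ : V → ℝ`,
  `Σ_v Σ_{w : R v w} φ v φ w ≤ Σ_v C_u(v) φ v²` (the adjacency form is dominated by the diagonal
  charge form; proof: symmetrise over the hop involution `(v,w) ↦ (w,v)` and apply reciprocal
  AM–GM hop by hop).
* `exists_charge_ge` — if `φ ≢ 0` some `v` in the support of `φ` has
  `C_u(v) · Σ φ² ≥ Σ_v Σ_{w : R v w} φ v φ w` (maximum ≥ Rayleigh quotient; with the Perron vector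
  of the hop graph this is `max_v C_u(v) ≥ λ_max`, Collatz–Wielandt read backwards — not needed
  below).
* `exists_mem_charge_ge_sum_degree` — `φ = 1_S`: some `v ∈ S` has
  `C_u(v) · |S| ≥ Σ_{v' ∈ S} #{w ∈ S : R v' w}`, i.e. the maximal charge is at least the MEAN
  DEGREE of the hop graph induced on `S`.

Reading (paper §5.20(19)): a sign-free kinetic floor `re ⟨ψ,Tψ⟩ ≥ -Σ_s C_u(s)|ψ(s)|²` obtained
by reciprocal AM–GM on hole hops can never have its constant `max_s C_u(s)` below the mean degree
of the hole-hop configuration graph; the companion files `SoloBlindHoleHopShell` (the mean degree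
of the `E`-hole shell of a `D`-regular graph is `D E (n-E)/(n-1)`) and `SoloBlindSignFreeFloorEndpoint`
(the `L × L` torus, `D = 4`) turn this into the endpoint `g ≥ 8 - O(L⁻²)` of road (α).

[this work; the inequality `2ab ≤ u a² + b²/u` is folklore]
-/

namespace Summit.HubbardSuperconductivity.HubbardSuperconductivity.Theorems.ReciprocalCharge

open Finset

/-! ### Reciprocal AM–GM -/

/-- **Reciprocal AM–GM.** If `0 ≤ u` and `1 ≤ u u'` then `2 a b ≤ u a² + u' b²` for all real
`a, b` (multiply by `u`: `u (u a² + u' b² - 2ab) = (u a - b)² + (u u' - 1) b² ≥ 0`). [folklore] -/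
theorem two_mul_le_weighted_sq_add {u u' : ℝ} (hu : 0 ≤ u) (huu : 1 ≤ u * u') (a b : ℝ) :
    2 * a * b ≤ u * a ^ 2 + u' * b ^ 2 := by
  have hu0 : 0 < u := by
    rcases hu.lt_or_eq with h | h
    · exact h
    · exfalso
      rw [← h, zero_mul] at huu
      exact absurd huu (by norm_num)
  have key : 0 ≤ u * (u * a ^ 2 + u' * b ^ 2 - 2 * a * b) := by
    have h1 : 0 ≤ (u * a - b) ^ 2 := sq_nonneg _
    have h2 : 0 ≤ (u * u' - 1) * b ^ 2 := mul_nonneg (sub_nonneg.2 huu) (sq_nonneg b)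
    nlinarith [h1, h2]
  have h3 : 0 ≤ u * a ^ 2 + u' * b ^ 2 - 2 * a * b := by
    by_contra h
    push Not at h
    have : u * (u * a ^ 2 + u' * b ^ 2 - 2 * a * b) < 0 := mul_neg_of_pos_of_neg hu0 h
    linarith
  linarith

/-! ### The charge form dominates the adjacency form -/

variable {V : Type*} [Fintype V] (R : V → V → Prop) [DecidableRel R]

/-- **Domination of the adjacency form by the charge form.** For a symmetric relation `R`, an
AM–GM admissible weight scheme `u` (`u ≥ 0`, `u v w · u w v ≥ 1` on hops) and every real `φ`:
`Σ_v Σ_{w : R v w} φ v φ w ≤ Σ_v (Σ_{w : R v w} u v w) φ v²`.  Proof: the hop sum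
`S = Σ_{R v w} u v w φ v²` equals, after the involution `(v,w) ↦ (w,v)`, `Σ_{R v w} u w v φ w²`;
hence `2S = Σ_{R v w} (u v w φ v² + u w v φ w²) ≥ Σ_{R v w} 2 φ v φ w`. [this work] -/
theorem adjForm_le_chargeForm (hR : ∀ v w, R v w → R w v) (u : V → V → ℝ)
    (hu : ∀ v w, R v w → 0 ≤ u v w) (huu : ∀ v w, R v w → 1 ≤ u v w * u w v) (φ : V → ℝ) :
    (∑ v, ∑ w, if R v w then φ v * φ w else 0) ≤
      ∑ v, (∑ w, if R v w then u v w else 0) * φ v ^ 2 := by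
  set S₁ : ℝ := ∑ v, ∑ w, if R v w then u v w * φ v ^ 2 else 0 with hS₁
  set S₂ : ℝ := ∑ v, ∑ w, if R v w then u w v * φ w ^ 2 else 0 with hS₂
  set A : ℝ := ∑ v, ∑ w, if R v w then φ v * φ w else 0 with hA
  -- the right-hand side is `S₁`
  have hrhs : (∑ v, (∑ w, if R v w then u v w else 0) * φ v ^ 2) = S₁ := by
    rw [hS₁]
    refine Finset.sum_congr rfl fun v _ => ?_
    rw [Finset.sum_mul]
    refine Finset.sum_congr rfl fun w _ => ?_
    split_ifs <;> simp
  -- the hop involution: `S₁ = S₂`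
  have hswap : S₁ = S₂ := by
    have h1 : S₁ = ∑ w, ∑ v, if R v w then u v w * φ v ^ 2 else 0 := by
      rw [hS₁]; exact Finset.sum_comm
    rw [h1, hS₂]
    refine Finset.sum_congr rfl fun a _ => Finset.sum_congr rfl fun b _ => ?_
    by_cases h : R a b
    · rw [if_pos (hR a b h), if_pos h]
    · have h' : ¬ R b a := fun h'' => h (hR b a h'')
      rw [if_neg h', if_neg h]
  -- `S₁ + S₂` hop by hop
  have hsum : S₁ + S₂ = ∑ v, ∑ w, if R v w then (u v w * φ v ^ 2 + u w v * φ w ^ 2) else 0 := by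
    rw [hS₁, hS₂, ← Finset.sum_add_distrib]
    refine Finset.sum_congr rfl fun v _ => ?_
    rw [← Finset.sum_add_distrib]
    refine Finset.sum_congr rfl fun w _ => ?_
    split_ifs <;> simp
  -- reciprocal AM–GM on every hop
  have hle : 2 * A ≤ S₁ + S₂ := by
    rw [hsum, hA, Finset.mul_sum]
    refine Finset.sum_le_sum fun v _ => ?_
    rw [Finset.mul_sum]
    refine Finset.sum_le_sum fun w _ => ?_
    split_ifs with h
    · have := two_mul_le_weighted_sq_add (hu v w h) (huu v w h) (φ v) (φ w)
      linarith
    · simp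
  rw [hrhs]
  linarith

/-- **Some charge is at least the Rayleigh quotient.** Under the hypotheses of
`adjForm_le_chargeForm`, if `φ ≢ 0` then some `v` with `φ v ≠ 0` satisfies
`(Σ_{w : R v w} u v w) · Σ_x φ x² ≥ Σ_x Σ_{w : R x w} φ x φ w`.  (With the Perron vector of the hop
graph: `max_v C_u(v) ≥ λ_max`; with an indicator: the mean degree, next lemma.) [this work] -/
theorem exists_charge_ge (hR : ∀ v w, R v w → R w v) (u : V → V → ℝ)
    (hu : ∀ v w, R v w → 0 ≤ u v w) (huu : ∀ v w, R v w → 1 ≤ u v w * u w v) (φ : V → ℝ)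
    (hφ : ∃ v, φ v ≠ 0) :
    ∃ v, φ v ≠ 0 ∧ (∑ x, ∑ w, if R x w then φ x * φ w else 0) ≤
      (∑ w, if R v w then u v w else 0) * ∑ x, φ x ^ 2 := by
  by_contra hcon
  push Not at hcon
  set A : ℝ := ∑ x, ∑ w, if R x w then φ x * φ w else 0 with hA
  set T : ℝ := ∑ x, φ x ^ 2 with hT
  obtain ⟨v₀, hv₀⟩ := hφ
  have hTpos : 0 < T := by
    rw [hT]
    exact lt_of_lt_of_le (by positivity : (0 : ℝ) < φ v₀ ^ 2)
      (Finset.single_le_sum (fun x _ => sq_nonneg (φ x)) (Finset.mem_univ v₀))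
  -- termwise: `(C v · T) φ v² ≤ A φ v²`, strictly at `v₀`
  have hterm : ∀ v, (∑ w, if R v w then u v w else 0) * T * φ v ^ 2 ≤ A * φ v ^ 2 := by
    intro v
    by_cases hv : φ v = 0
    · simp [hv]
    · exact mul_le_mul_of_nonneg_right (le_of_lt (hcon v hv)) (sq_nonneg _)
  have hstrict : (∑ w, if R v₀ w then u v₀ w else 0) * T * φ v₀ ^ 2 < A * φ v₀ ^ 2 :=
    mul_lt_mul_of_pos_right (hcon v₀ hv₀) (by positivity)
  have hlt : (∑ v, (∑ w, if R v w then u v w else 0) * T * φ v ^ 2) < ∑ v, A * φ v ^ 2 :=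
    Finset.sum_lt_sum (fun v _ => hterm v) ⟨v₀, Finset.mem_univ _, hstrict⟩
  have hrhs : (∑ v, A * φ v ^ 2) = A * T := by rw [hT, Finset.mul_sum]
  have hlhs : (∑ v, (∑ w, if R v w then u v w else 0) * T * φ v ^ 2) =
      T * ∑ v, (∑ w, if R v w then u v w else 0) * φ v ^ 2 := by
    rw [Finset.mul_sum]
    refine Finset.sum_congr rfl fun v _ => ?_
    ring
  have hdom := adjForm_le_chargeForm R hR u hu huu φ
  rw [← hA] at hdom
  have h1 : T * A ≤ T * ∑ v, (∑ w, if R v w then u v w else 0) * φ v ^ 2 :=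
    mul_le_mul_of_nonneg_left hdom hTpos.le
  rw [hrhs, hlhs] at hlt
  linarith

/-- **Some charge is at least the mean degree.** Under the hypotheses of `adjForm_le_chargeForm`,
for every nonempty finite set `S` of vertices some `v ∈ S` has
`(Σ_{w : R v w} u v w) · |S| ≥ Σ_{v' ∈ S} #{w ∈ S : R v' w}` — the maximal charge on `S` is at
least the mean degree of the hop graph induced on `S` (take `φ = 1_S` in `exists_charge_ge`).
[this work] -/
theorem exists_mem_charge_ge_sum_degree (hR : ∀ v w, R v w → R w v) (u : V → V → ℝ)
    (hu : ∀ v w, R v w → 0 ≤ u v w) (huu : ∀ v w, R v w → 1 ≤ u v w * u w v) (S : Finset V)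
    (hS : S.Nonempty) :
    ∃ v ∈ S, (∑ v' ∈ S, (((S.filter fun w => R v' w).card : ℕ) : ℝ)) ≤
      (∑ w, if R v w then u v w else 0) * S.card := by
  classical
  set φ : V → ℝ := fun v => if v ∈ S then 1 else 0 with hφ
  obtain ⟨v₀, hv₀S⟩ := hS
  have hφne : ∃ v, φ v ≠ 0 := ⟨v₀, by simp [hφ, hv₀S]⟩
  obtain ⟨v, hv, hle⟩ := exists_charge_ge R hR u hu huu φ hφne
  have hvS : v ∈ S := by
    by_contra h
    exact hv (by simp [hφ, h])
  refine ⟨v, hvS, ?_⟩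
  -- `Σ φ² = |S|`
  have hT : (∑ x, φ x ^ 2) = (S.card : ℝ) := by
    have : ∀ x, φ x ^ 2 = if x ∈ S then (1 : ℝ) else 0 := by
      intro x; by_cases hx : x ∈ S <;> simp [hφ, hx]
    simp_rw [this]
    rw [Finset.sum_ite_mem, Finset.univ_inter, Finset.sum_const, nsmul_eq_mul, mul_one]
  -- `Σ_x Σ_w [R x w] φ x φ w = Σ_{x ∈ S} #{w ∈ S : R x w}`
  have hA : (∑ x, ∑ w, if R x w then φ x * φ w else 0) =
      ∑ v' ∈ S, (((S.filter fun w => R v' w).card : ℕ) : ℝ) := by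
    have h2 : ∀ x, (∑ w, if R x w then φ x * φ w else 0) =
        if x ∈ S then (((S.filter fun w => R x w).card : ℕ) : ℝ) else 0 := by
      intro x
      by_cases hx : x ∈ S
      · rw [if_pos hx]
        have h1 : ∀ w, (if R x w then φ x * φ w else 0) =
            if w ∈ S then (if R x w then (1 : ℝ) else 0) else 0 := by
          intro w
          by_cases hw : w ∈ S <;> by_cases h : R x w <;> simp [hφ, hx, hw, h]
        simp_rw [h1]
        rw [Finset.sum_ite_mem, Finset.univ_inter, Finset.sum_boole]
      · rw [if_neg hx]
        refine Finset.sum_eq_zero fun w _ => ?_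
        simp [hφ, hx]
    simp_rw [h2]
    rw [Finset.sum_ite_mem, Finset.univ_inter]
  rw [hA, hT] at hle
  exact hle

end Summit.HubbardSuperconductivity.HubbardSuperconductivity.Theorems.ReciprocalCharge
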